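import Summits.Ventures.HodgeRepro2.T5HermitianClassify
import Summits.Ventures.HodgeRepro2.T5FinitePlaceQuadraticStar

/-!
# Row N2.8.1 (i) at a non-split place: isometry ⟺ Hilbert symbol, modulo `(U)` (cell pub-hodge-repro2, seat p3)

Tier-5 N2 support, row N2.8.1 (i) of route/T5-N2-route-3.md: «For every finite v: `W₁₂,v ≅ W₃₄,v ⟺ (c, θ/v) = 1`
— non-split v by Shimura Lemma 1.6 (S-6; N2.7.1) + O'Meara §65A «α is a local norm at 𝔭 iff (α, θ/𝔭) = 1»
(S-16)», with `c` the ratio of the `d₀`-representatives. This file composes files 136 and 138 on the route's own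
completion `E_w` (files 115–119): for two invertible hermitian Gram matrices `H, H'` of the same size over `E_w`
(file 119's conjugation as `star`) whose determinants differ by `c ∈ F_v^×`,
**`isCongruent_iff_hilbertSolvable`**: `H ≅ H' ⟺ c ξ² + θ η² = 1` is solvable in `F_v`
— modulo the one hypothesis `(U) = BinaryUniversal E_w` of file 136 (a binder; not claimed). The characteristic
hypothesis of file 135 is discharged from `star √θ = −√θ ≠ √θ` (`exists_add_star_ne_zero_local`; `√θ ≠ 0` is
file 118's `algebraMap_s_ne_zero`).
Mathlib + files 133–138 only. No display; no device. §8(d): uses an L-value-free non-vanishing device: NO.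
-/

namespace Summit.Ventures.HodgeRepro2.T5FinitePlaceIsometryCriterion

open IsDedekindDomain IsDedekindDomain.HeightOneSpectrum NumberField Module Matrix
open scoped Summit.Ventures.HodgeRepro2.T5FinitePlaceLiesOver
open Summit.Ventures.HodgeRepro2.T5FinitePlaceLiesOver Summit.Ventures.HodgeRepro2.T5FinitePlaceQuadratic
  Summit.Ventures.HodgeRepro2.T5FinitePlaceTensorEquiv Summit.Ventures.HodgeRepro2.T5FinitePlaceLocalNorm
  Summit.Ventures.HodgeRepro2.T5FinitePlaceStar Summit.Ventures.HodgeRepro2.T5QuadraticStarNorm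
  Summit.Ventures.HodgeRepro2.T5HilbertSymbolNorm Summit.Ventures.HodgeRepro2.T5HermitianDetClass
  Summit.Ventures.HodgeRepro2.T5HermitianDiagonalize Summit.Ventures.HodgeRepro2.T5HermitianClassify
  Summit.Ventures.HodgeRepro2.T5FinitePlaceQuadraticStar

variable {F E : Type*} [Field F] [NumberField F] [Field E] [NumberField E] [Algebra F E]
  [Algebra.IsQuadraticExtension F E]
variable (v : HeightOneSpectrum (𝓞 F)) (w : HeightOneSpectrum (𝓞 E)) [w.asIdeal.LiesOver v.asIdeal]
variable {s : E} {θ : F}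
variable (hs : s ^ 2 = algebraMap F E θ) (hspan : Submodule.span F {(1 : E), s} = ⊤)
  (hsq : ¬ IsSquare (algebraMap F (v.adicCompletion F) θ)) (c : E ≃ₐ[F] E) (hc : c s = -s)

/-- The involution of `E_w` is non-trivial (`star √θ = −√θ ≠ √θ`), so file 135's hypothesis holds. -/
theorem exists_add_star_ne_zero_local :
    letI := localStarRing v w hs hspan hsq c hc
    ∃ μ : w.adicCompletion E, μ + star μ ≠ 0 := by
  letI := localStarRing v w hs hspan hsq c hc
  haveI : CharZero (w.adicCompletion E) :=
    charZero_of_injective_algebraMap (algebraMap ℚ (w.adicCompletion E)).injective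
  refine exists_add_star_ne_zero_of_star_ne ⟨algebraMap E (w.adicCompletion E) s, ?_⟩
  rw [star_algebraMap_s v w hs hspan hsq c hc]
  intro h
  apply algebraMap_s_ne_zero v w hs hsq
  have : (2 : w.adicCompletion E) * algebraMap E (w.adicCompletion E) s = 0 := by linear_combination -h
  rcases mul_eq_zero.mp this with h2 | h2
  · exact absurd h2 two_ne_zero
  · exact h2

/-- **Row N2.8.1 (i) at a non-split place, modulo `(U)`.** Over `E_w` with its conjugation, two invertible
hermitian matrices `H, H'` of the same size with `det H' = c · det H`, `c ∈ F_v^×`, are congruent iff the Hilbert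
symbol `(c, θ)_v` is `+1`, i.e. `c ξ² + θ η² = 1` is solvable in `F_v`. -/
theorem isCongruent_iff_hilbertSolvable {ι : Type*} [Fintype ι] [DecidableEq ι]
    (hU : letI := localStarRing v w hs hspan hsq c hc; BinaryUniversal (w.adicCompletion E))
    {H H' : Matrix ι ι (w.adicCompletion E)}
    (hH : letI := localStarRing v w hs hspan hsq c hc; H.IsHermitian)
    (hH' : letI := localStarRing v w hs hspan hsq c hc; H'.IsHermitian)
    (hdet : IsUnit H.det) {a : v.adicCompletion F} (ha : a ≠ 0)
    (hratio : H'.det = algebraMap (v.adicCompletion F) (w.adicCompletion E) a * H.det) :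
    letI := localStarRing v w hs hspan hsq c hc
    IsCongruent H H' ↔ HilbertSolvable a (algebraMap F (v.adicCompletion F) θ) := by
  letI := localStarRing v w hs hspan hsq c hc
  rw [isCongruent_iff_exists_det_eq (exists_add_star_ne_zero_local v w hs hspan hsq c hc) hU hH hH' hdet,
    hilbertSolvable_iff_isUnitNorm_local v w hs hspan hsq c hc a ha]
  have hdet0 : H.det ≠ 0 := isUnit_iff_ne_zero.mp hdet
  constructor
  · rintro ⟨u, hu, h⟩
    refine ⟨u, isUnit_iff_ne_zero.mpr hu, ?_⟩
    rw [hratio] at h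
    exact mul_right_cancel₀ hdet0 h
  · rintro ⟨u, hu, h⟩
    refine ⟨u, isUnit_iff_ne_zero.mp hu, ?_⟩
    rw [hratio, h]

end Summit.Ventures.HodgeRepro2.T5FinitePlaceIsometryCriterion
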